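import Summits.ABC.ABC.Theses.IsogenyGlueCongruence
import Literature.AlgebraicGeometry.Motives.AbelianVarietyPoincareCompleteReducibility
import Literature.AlgebraicGeometry.Motives.AbelianVarietyEndGaloisFinite
import Literature.AlgebraicGeometry.Motives.AbelianVarietyImageSimpleProofs
import Literature.AlgebraicGeometry.Motives.AbelianVarietyDimZeroProofs
import Literature.AlgebraicGeometry.Motives.AbelianVarietyIsogenyProofs
import Literature.AlgebraicGeometry.Motives.AbelianVarietyProductDimProofs
import Literature.NumberTheory.DiophantineGeometry.AVIsogenyTateHoldsProofs
import Literature.NumberTheory.DiophantineGeometry.AVKernelHopf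
import Literature.NumberTheory.DiophantineGeometry.AVIsogenyTateHomProofs
import Literature.NumberTheory.DiophantineGeometry.AVIsogenyTateFreeHomProofs
import Literature.NumberTheory.DiophantineGeometry.AVIsogenyQuasiInverse
import Literature.NumberTheory.DiophantineGeometry.AVIsogenyFlat
import Literature.NumberTheory.DiophantineGeometry.AVIsogenyTateHomPoincareProofs
import HarnessLib


/-!
# The `E`-isotypic quasi-projector of an abelian variety over an algebraically closed field

Helper file (1/2) for stub `stub_geomIsotypicSplitting` of line `Sketch` (isotypic–Minkowski
reduction) of crux U `Summit.ABC.ABC.Theses.IsogenyGlueCongruence.EllipticGluingPrimeBound`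
(stmt-ABC-13919); the stub itself is proved in the companion file
`…EllipticGluingPrimeBoundStubGeomIsotypicSplitting`.

* `exists_quasiProjector` — over `L = L̄`, for `E₀` of dimension `1` and any abelian variety `X/L`
  there are `e ∈ End X` in the two-sided ideal spanned by the composites `X → E₀ → X` and `N ≥ 1`
  with `f ≫ e = N • f` for every `f : E₀ → X`. Induction on `dim X`: if some `f₀ : E₀ → X` is
  non-zero, its image `Y` (`AbelianVariety.image`) is an elliptic curve isogenous to `E₀`,
  `Y ⊞ Z → X` is an isogeny for a Poincaré complement `Z`
  (`AbelianVariety.poincare_complete_reducibility`, over `L̄` only — which is all that is used), and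
  the quasi-projector of `Z` is glued with `[k]_Y = s ≫ t` through quasi-inverses
  (`IsIsogeny.exists_nsmul_inverse_holds`).
* small helpers on homomorphisms of abelian varieties over any field: surjective homomorphisms are
  epimorphisms (`eq_of_comp_eq_of_surjective`, Mathlib `ext_of_isDominant_of_isSeparated`), closed
  immersions are monomorphisms, `dim` along surjections, a surjective zero map has a
  zero-dimensional target, base change of `n • f`, of surjectivity and of closed immersions;
  `Normal ℚ ℚ̄`; agreement of additive maps on a subgroup closure.

Everything is proved (axioms `propext`, `Classical.choice`, `Quot.sound`); no `def`, no named fact.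

## References

* D. Mumford, *Abelian Varieties* (1970), §19, Thm. 1 (Poincaré) and Remark p. 169.
* J. S. Milne, *Abelian Varieties*, in Cornell–Silverman, *Arithmetic Geometry* (1986), Prop. 12.1.
-/

noncomputable section

-- `Summit.<Summit>.<Problem>` is the mandated summit-side namespace (CONVENTIONS §2); for the
-- single-conjunct summit `ABC` the two coincide, so the duplicate `ABC.ABC` is deliberate.
set_option linter.dupNamespace false

namespace Summit.ABC.ABC.Theorems.IsotypicMinkowski

open CategoryTheory CategoryTheory.Limits AlgebraicGeometry
open Literature.AlgebraicGeometry.Motives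
open Summit.ABC.ABC.Theses.IsogenyGlueCongruence

universe u

section Helpers

open Literature.AlgebraicGeometry.Motives.AbelianVariety

variable {K : Type u} [Field K]

/-- A surjective homomorphism of abelian varieties is an epimorphism: `t ≫ a = t ≫ b` with `t`
surjective forces `a = b` (the source of `a`, `b` is reduced and the target separated over `K`;
Mathlib `ext_of_isDominant_of_isSeparated`). -/
theorem eq_of_comp_eq_of_surjective {W Y Z : AbelianVariety K} (t : W ⟶ Y)
    [Surjective (Hom.toSchemeHom t)] {a b : Y ⟶ Z} (h : t ≫ a = t ≫ b) : a = b := by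
  apply hom_ext_toSchemeHom
  haveI : IsIntegral Y.X.left := GeometricallyIntegral.isIntegral_of_subsingleton Y.X.hom
  refine ext_of_isDominant_of_isSeparated Z.X.hom ?_ (Hom.toSchemeHom t) ?_
  · rw [toSchemeHom_comp_hom, toSchemeHom_comp_hom]
  · change Hom.toSchemeHom (t ≫ a) = Hom.toSchemeHom (t ≫ b)
    rw [h]

/-- A closed-immersion homomorphism is a monomorphism: `a ≫ i = b ≫ i` forces `a = b`. -/
theorem eq_of_comp_eq_of_isClosedImmersion {W Y Z : AbelianVariety K} (i : Y ⟶ Z)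
    [IsClosedImmersion (Hom.toSchemeHom i)] {a b : W ⟶ Y} (h : a ≫ i = b ≫ i) : a = b := by
  apply hom_ext_toSchemeHom
  rw [← cancel_mono (Hom.toSchemeHom i)]
  exact congrArg Hom.toSchemeHom h

/-- A surjective homomorphism does not increase dimension: `dim Y ≤ dim X`. -/
theorem dim_le_of_surjective {X Y : AbelianVariety K} (f : X ⟶ Y) [Surjective (Hom.toSchemeHom f)] :
    Y.dim ≤ X.dim := by
  have h := Literature.AlgebraicGeometry.Motives.Scheme.topologicalKrullDim_le_of_universallyClosed_of_surjective
    (Hom.toSchemeHom f)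
  rw [topologicalKrullDim_left, topologicalKrullDim_left] at h
  exact_mod_cast h

/-- A surjective ZERO homomorphism has a zero-dimensional target (its image is the origin;
adapted from `AbelianVariety.not_isIsogeny_zero_of_dim_pos`). -/
theorem dim_eq_zero_of_surjective_zero {X Y : AbelianVariety K} (f : X ⟶ Y)
    [hs : Surjective (Hom.toSchemeHom f)] (hf : f = 0) : Y.dim = 0 := by
  subst hf
  have hsurj := hs.1
  have h0 : Hom.toSchemeHom (0 : X ⟶ Y) = X.X.hom ≫ unitPt Y := by
    change ((0 : X ⟶ Y).hom.hom.hom).left = _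
    rw [hom_zero, Grp.Hom.hom_one, Mon.Hom.hom_one, one_left]
  haveI : Subsingleton Y.X.left := ⟨fun a b => by
    obtain ⟨a', rfl⟩ := hsurj a
    obtain ⟨b', rfl⟩ := hsurj b
    have ha : (Hom.toSchemeHom (0 : X ⟶ Y)).base a' ∈ Set.range (unitPt Y).base :=
      ⟨X.X.hom.base a', by rw [h0]; rfl⟩
    have hb : (Hom.toSchemeHom (0 : X ⟶ Y)).base b' ∈ Set.range (unitPt Y).base :=
      ⟨X.X.hom.base b', by rw [h0]; rfl⟩
    rw [range_unitPt, Set.mem_singleton_iff] at ha hb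
    rw [ha, hb]⟩
  have hle := topologicalKrullDim_zero_of_discreteTopology Y.X.left
  rw [topologicalKrullDim_left] at hle
  have : Y.dim ≤ 0 := by exact_mod_cast hle
  omega

/-- If `a ≫ b` is surjective then so is `b`. -/
theorem surjective_of_comp {X Y Z : AbelianVariety K} (a : X ⟶ Y) (b : Y ⟶ Z)
    [h : Surjective (Hom.toSchemeHom (a ≫ b))] : Surjective (Hom.toSchemeHom b) := by
  have h' : Surjective (Hom.toSchemeHom a ≫ Hom.toSchemeHom b) := h
  exact Surjective.of_comp (f := Hom.toSchemeHom a) (g := Hom.toSchemeHom b)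

/-- `[n]_X` is surjective for `n ≠ 0`. -/
theorem surjective_nsmul_id (X : AbelianVariety K) {n : ℕ} (hn : 0 < n) :
    Surjective (Hom.toSchemeHom (n • 𝟙 X)) := by
  have h := isIsogeny_zsmul_id_holds X (n : ℤ) (by exact_mod_cast hn.ne')
  rw [natCast_zsmul] at h
  exact h.1

/-- Base change preserves `ℕ`-multiples of homomorphisms. -/
theorem baseChange_nsmul (L : Type u) [Field L] [Algebra K L] {X Y : AbelianVariety K} (f : X ⟶ Y)
    (n : ℕ) : Hom.baseChange L (n • f) = n • Hom.baseChange L f :=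
  map_nsmul (AddMonoidHom.mk' (fun g : X ⟶ Y => Hom.baseChange L g) (Hom.baseChange_add L)) n f

/-- Base change preserves surjectivity of homomorphisms. -/
theorem surjective_baseChange (L : Type u) [Field L] [Algebra K L] {X Y : AbelianVariety K}
    (f : X ⟶ Y) [h : Surjective (Hom.toSchemeHom f)] :
    Surjective (Hom.toSchemeHom (Hom.baseChange L f)) :=
  MorphismProperty.of_isPullback (P := @Surjective) (isPullback_toSchemeHom_baseChange L f).flip h

/-- Base change preserves closed-immersion homomorphisms. -/
theorem isClosedImmersion_baseChange (L : Type u) [Field L] [Algebra K L] {X Y : AbelianVariety K}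
    (f : X ⟶ Y) [h : IsClosedImmersion (Hom.toSchemeHom f)] :
    IsClosedImmersion (Hom.toSchemeHom (Hom.baseChange L f)) :=
  MorphismProperty.of_isPullback (P := @IsClosedImmersion)
    (isPullback_toSchemeHom_baseChange L f).flip h

end Helpers

/-- `ℚ̄ / ℚ` is normal (the instance is supplied by hand, as elsewhere in the tree, because the
`IsAlgClosure` instance is keyed on `AlgebraicClosure.instAlgebra`). -/
theorem normal_algebraicClosure_rat : Normal ℚ (AlgebraicClosure ℚ) :=
  @IsAlgClosure.normal ℚ (AlgebraicClosure ℚ) _ _ (AlgebraicClosure.instAlgebra ℚ) inferInstance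

/-- Two additive maps agreeing on a generating set agree on the generated subgroup
(Mathlib `AddMonoidHom.eqOn_closure`, pointwise form). -/
theorem addMonoidHom_eq_of_mem_closure {A C : Type*} [AddCommGroup A] [AddCommGroup C]
    {S : Set A} (φ ψ : A →+ C) (h : ∀ x ∈ S, φ x = ψ x) {x : A}
    (hx : x ∈ AddSubgroup.closure S) : φ x = ψ x :=
  AddMonoidHom.eqOn_closure (f := φ) (g := ψ) (fun y hy => h y hy) hx


/-! ### Over an algebraically closed field: a quasi-projector onto the `E`-isotypic part -/

/-! ### Over an algebraically closed field: a quasi-projector onto the `E`-isotypic part -/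

section QuasiProjector

open Literature.AlgebraicGeometry.Motives.AbelianVariety

/-- **The `E₀`-isotypic quasi-projector over an algebraically closed field** (registered sub-goal
of stub `stub_geomIsotypicSplitting`). For `E₀` of dimension `1` and any `X` there are `e ∈ End X`
and `N ≥ 1` with `e` in the two-sided ideal spanned by the composites `X → E₀ → X` and
`f ≫ e = N • f` for every `f : E₀ → X`. Induction on `dim X` by Poincaré's complete reducibility
theorem over `L = L̄` (`AbelianVariety.poincare_complete_reducibility`): if some `f₀ : E₀ → X` is
non-zero, its image `Y` is an elliptic curve isogenous to `E₀`, `X ∼ Y × Z` for a Poincaré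
complement `Z`, and the quasi-projector of `Z` (induction) is glued with `[k]_Y = s ≫ t`
(`t = E₀ ↠ Y`, `s` a quasi-inverse) through a quasi-inverse of `Y ⊞ Z → X`. -/
theorem exists_quasiProjector {L : Type} [Field L] [IsAlgClosed L] (E₀ : AbelianVariety.{0} L)
    (hE₀ : E₀.dim = 1) (n : ℕ) (X : AbelianVariety.{0} L) (hX : X.dim = n) :
    ∃ (e : X ⟶ X) (N : ℕ), 0 < N ∧
      e ∈ AddSubgroup.closure {x : X ⟶ X | ∃ (π : X ⟶ E₀) (ι : E₀ ⟶ X), x = π ≫ ι} ∧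
      ∀ f : E₀ ⟶ X, f ≫ e = N • f := by
  induction n using Nat.strong_induction_on generalizing X with
  | _ n ih =>
  by_cases hzero : ∀ f : E₀ ⟶ X, f = 0
  · exact ⟨0, 1, one_pos, zero_mem _, fun f => by rw [hzero f, Limits.zero_comp, smul_zero]⟩
  push Not at hzero
  obtain ⟨f₀, hf₀⟩ := hzero
  have hgen : ∀ {W : AbelianVariety L} (π : W ⟶ E₀) (ι : E₀ ⟶ W),
      π ≫ ι ∈ AddSubgroup.closure {x : W ⟶ W | ∃ (π : W ⟶ E₀) (ι : E₀ ⟶ W), x = π ≫ ι} :=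
    fun π ι => AddSubgroup.subset_closure ⟨π, ι, rfl⟩
  -- the image `Y` of `f₀`, an elliptic curve, and the isogeny `t : E₀ ↠ Y`
  have hYpos : 0 < (image f₀).dim := dim_image_pos f₀ hf₀
  have hYle : (image f₀).dim ≤ 1 := hE₀ ▸ dim_image_le_left f₀
  have hY1 : (image f₀).dim = 1 := le_antisymm hYle hYpos
  have ht : IsIsogeny (toImage f₀) :=
    isIsogeny_of_surjective_of_dim_eq (toImage f₀) (hE₀.trans hY1.symm)
  obtain ⟨s, k, hk, hts, hst⟩ := IsIsogeny.exists_nsmul_inverse_holds ht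
  -- a Poincaré complement `Z` of `Y` and a quasi-inverse `ψ` of `Y ⊞ Z → X`
  obtain ⟨Z, j, hj, hφ⟩ := poincare_complete_reducibility (imageι f₀)
  obtain ⟨ψ, m, hm, hφψ, hψφ⟩ := IsIsogeny.exists_nsmul_inverse_holds hφ
  have hdimYZ : (image f₀ ⊞ Z).dim = X.dim := dim_eq_of_isIsogeny hφ
  rw [dim_biprod, hY1, hX] at hdimYZ
  obtain ⟨eZ, nZ, hnZ, heZ, hfZ⟩ := ih Z.dim (by omega) Z rfl
  -- the quasi-projector of `X`
  refine ⟨ψ ≫ (nZ • (biprod.fst ≫ s ≫ toImage f₀ ≫ biprod.inl) +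
      k • (biprod.snd ≫ eZ ≫ biprod.inr)) ≫ biprod.desc (imageι f₀) j, nZ * k * m,
    by positivity, ?_, ?_⟩
  · -- membership in the ideal
    simp only [Preadditive.comp_add, Preadditive.add_comp, Preadditive.comp_nsmul,
      Preadditive.nsmul_comp, Category.assoc]
    refine add_mem (AddSubgroup.nsmul_mem _ (by
      simpa only [Category.assoc] using
        hgen (ψ ≫ biprod.fst ≫ s) (toImage f₀ ≫ biprod.inl ≫ biprod.desc (imageι f₀) j)) _)
      (AddSubgroup.nsmul_mem _ ?_ _)
    -- transport the ideal of `Z` along `x ↦ ψ ≫ snd ≫ x ≫ inr ≫ (i, j)`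
    let Φ : (Z ⟶ Z) →+ (X ⟶ X) :=
      AddMonoidHom.mk' (fun x => ψ ≫ biprod.snd ≫ x ≫ biprod.inr ≫ biprod.desc (imageι f₀) j)
        (fun x y => by simp only [Preadditive.comp_add, Preadditive.add_comp])
    have hle : AddSubgroup.closure {x : Z ⟶ Z | ∃ (π : Z ⟶ E₀) (ι : E₀ ⟶ Z), x = π ≫ ι} ≤
        (AddSubgroup.closure {x : X ⟶ X | ∃ (π : X ⟶ E₀) (ι : E₀ ⟶ X), x = π ≫ ι}).comap Φ := by
      rw [AddSubgroup.closure_le]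
      rintro x ⟨π, ι, rfl⟩
      refine AddSubgroup.subset_closure ⟨ψ ≫ biprod.snd ≫ π, ι ≫ biprod.inr ≫ biprod.desc (imageι f₀) j, ?_⟩
      simp only [Φ, AddMonoidHom.mk'_apply, Category.assoc]
    exact hle heZ
  · -- action on `f : E₀ → X`
    intro f
    have h1 : f ≫ ψ ≫ biprod.fst ≫ s ≫ toImage f₀ ≫ biprod.inl ≫ biprod.desc (imageι f₀) j =
        k • (f ≫ ψ ≫ biprod.fst ≫ biprod.inl ≫ biprod.desc (imageι f₀) j) := by
      rw [reassoc_of% hst, Preadditive.nsmul_comp, Category.id_comp, Preadditive.comp_nsmul,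
        Preadditive.comp_nsmul, Preadditive.comp_nsmul]
    have h2 : f ≫ ψ ≫ biprod.snd ≫ eZ ≫ biprod.inr ≫ biprod.desc (imageι f₀) j =
        nZ • (f ≫ ψ ≫ biprod.snd ≫ biprod.inr ≫ biprod.desc (imageι f₀) j) := by
      have h := hfZ (f ≫ ψ ≫ biprod.snd)
      simp only [Category.assoc] at h
      rw [reassoc_of% h]
      simp only [Category.assoc, Preadditive.nsmul_comp]
    have htot : f ≫ ψ ≫ biprod.fst ≫ biprod.inl ≫ biprod.desc (imageι f₀) j +
        f ≫ ψ ≫ biprod.snd ≫ biprod.inr ≫ biprod.desc (imageι f₀) j = m • f := by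
      calc _ = f ≫ ψ ≫ ((biprod.fst ≫ biprod.inl + biprod.snd ≫ biprod.inr) ≫
            biprod.desc (imageι f₀) j) := by
            simp only [Preadditive.add_comp, Preadditive.comp_add, Category.assoc]
        _ = m • f := by
            rw [biprod.total, Category.id_comp, hψφ, Preadditive.comp_nsmul, Category.comp_id]
    simp only [Preadditive.comp_add, Preadditive.add_comp, Preadditive.comp_nsmul,
      Preadditive.nsmul_comp, Category.assoc]
    rw [h1, h2, smul_smul, smul_smul, mul_comm k nZ, ← smul_add, htot, smul_smul]

end QuasiProjector

end Summit.ABC.ABC.Theorems.IsotypicMinkowski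

end
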